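import Literature.Topology.FourManifolds.InverseFunctionTheorem
import Mathlib.Analysis.InnerProductSpace.PiL2
import Mathlib.Geometry.Manifold.Instances.Real
import Mathlib.LinearAlgebra.FiniteDimensional.Basic
import Mathlib.Analysis.Calculus.Deriv.MeanValue
import Mathlib.Topology.Order.IntermediateValue

/-!
# Stub `stub_radialDiffeomorph` of line `contact-isotopy-gromov-cone` for crux `SchoenfliesSplit.SchsplitCerf` (stmt-SmoothPoincare4-8758)

**Radial diffeomorphisms of `ℝ⁴`.**  If `g : ℝ⁴ → ℝ` is `C^∞`, positive, and radially
non-decreasing in the weak sense `0 ≤ Dg_x(x)` for every `x`, then `D(x) = g(x) • x` is (the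
underlying map of) a diffeomorphism `ℝ⁴ ≃ₘ ℝ⁴`.

Proof (elementary calculus, folklore):
* `D` is smooth (`ContDiff.smul`), with differential `L_x v = g(x) v + (Dg_x v) x`
  (`HasFDerivAt.smul`); `L_x` is injective (apply `Dg_x` to `L_x v = 0` to get
  `Dg_x v · (g x + Dg_x x) = 0`, whence `Dg_x v = 0` and then `g x • v = 0`), hence a linear
  isomorphism of the finite-dimensional space `ℝ⁴` (`LinearEquiv.ofInjectiveEndo`), so `D` is a
  local diffeomorphism everywhere by the inverse function theorem on manifolds
  (`Literature.Topology.FourManifolds.isLocalDiffeomorphAt_of_hasFDerivAt_writtenInExtChartAt`).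
* On each ray the scalar `f_x(t) = t g(t x)` has derivative `g(tx) + Dg_{tx}(tx) ≥ g(tx) > 0`, so it
  is strictly increasing (`strictMono_of_hasDerivAt_pos`): this gives injectivity of `D`
  (`D x = D y` forces `y = s x` with `f_x(s) = f_x(1)`).  Moreover `s ↦ g(s x)` is monotone on
  `[0, ∞)` (derivative `s⁻¹ Dg_{sx}(sx) ≥ 0`), so `f_y(1/g 0) ≥ 1` and the intermediate value
  theorem yields `t` with `t g(t y) = 1`, i.e. `D(t y) = y`: `D` is surjective.
* A bijective local diffeomorphism is a diffeomorphism
  (`IsLocalDiffeomorph.diffeomorphOfBijective`).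
-/

noncomputable section

-- the prescribed namespace `Summit.<P>.<Sub>.…` duplicates `SmoothPoincare4` (P = Sub)
set_option linter.dupNamespace false

open scoped Manifold ContDiff Topology
open Set Function Metric
open Literature.Topology.FourManifolds

namespace Summit.SmoothPoincare4.SmoothPoincare4.Theorems.SchsplitCerf.ContactIsotopyGromovCone

/-- The model `ℝ⁴`. -/
local notation "E4" => EuclideanSpace ℝ (Fin 4)

namespace RadialDiffeomorph

/-! ### Calculus along rays -/

/-- The derivative of `s ↦ g (s • x)` at `t` is `Dg_{t x}(x)` (chain rule). [folklore] -/
theorem hasDerivAt_comp_ray {g : E4 → ℝ} (hg : Differentiable ℝ g) (x : E4) (t : ℝ) :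
    HasDerivAt (fun s : ℝ => g (s • x)) (fderiv ℝ g (t • x) x) t := by
  have h1 : HasDerivAt (fun s : ℝ => s • x) x t := by
    simpa only [one_smul] using (hasDerivAt_id' (𝕜 := ℝ) (x := t)).smul_const x
  exact (hg (t • x)).hasFDerivAt.comp_hasDerivAt t h1

/-- The derivative of the ray function `f_x(s) = s g(s x)` at `t` is `g(t x) + Dg_{t x}(t x)`
(product and chain rules). [folklore] -/
theorem hasDerivAt_rayFun {g : E4 → ℝ} (hg : Differentiable ℝ g) (x : E4) (t : ℝ) :
    HasDerivAt (fun s : ℝ => s * g (s • x)) (g (t • x) + fderiv ℝ g (t • x) (t • x)) t := by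
  have h := (hasDerivAt_id' (𝕜 := ℝ) (x := t)).fun_mul (hasDerivAt_comp_ray hg x t)
  exact h.congr_deriv (by rw [one_mul, map_smul, smul_eq_mul])

/-- The ray function `f_x(s) = s g(s x)` is strictly increasing on `ℝ` when `g > 0` and
`0 ≤ Dg_y(y)` for all `y`: its derivative is `g(s x) + Dg_{s x}(s x) > 0`. [folklore] -/
theorem strictMono_rayFun {g : E4 → ℝ} (hg : Differentiable ℝ g) (hpos : ∀ x, 0 < g x)
    (hrad : ∀ x : E4, 0 ≤ fderiv ℝ g x x) (x : E4) :
    StrictMono (fun s : ℝ => s * g (s • x)) :=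
  strictMono_of_hasDerivAt_pos (fun t => hasDerivAt_rayFun hg x t)
    fun _ => add_pos_of_pos_of_nonneg (hpos _) (hrad _)

/-- Along each ray `g` is bounded below by `g 0` on the positive side: `s ↦ g (s • x)` is
monotone on `[0, ∞)` since its derivative `Dg_{s x}(x) = s⁻¹ Dg_{s x}(s x)` is non-negative for
`s > 0`. [folklore] -/
theorem apply_zero_le {g : E4 → ℝ} (hg : Differentiable ℝ g)
    (hrad : ∀ x : E4, 0 ≤ fderiv ℝ g x x) (x : E4) {t : ℝ} (ht : 0 ≤ t) :
    g 0 ≤ g (t • x) := by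
  have hcont : Continuous (fun s : ℝ => g (s • x)) :=
    hg.continuous.comp (continuous_id.smul continuous_const)
  have hmono : MonotoneOn (fun s : ℝ => g (s • x)) (Ici 0) := by
    refine monotoneOn_of_hasDerivWithinAt_nonneg (f' := fun s => fderiv ℝ g (s • x) x)
      (convex_Ici 0) hcont.continuousOn
      (fun s _ => (hasDerivAt_comp_ray hg x s).hasDerivWithinAt) fun s hs => ?_
    rw [interior_Ici] at hs
    have hs' : (0 : ℝ) < s := hs
    have h := hrad (s • x)
    rw [map_smul, smul_eq_mul] at h
    exact (mul_nonneg_iff_of_pos_left hs').1 h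
  have h := hmono (Set.self_mem_Ici (a := (0 : ℝ))) (Set.mem_Ici.2 ht) ht
  simpa only [zero_smul] using h

/-- For every `y` there is `t` with `t g(t y) = 1` (intermediate value theorem on
`[0, 1 / g 0]`, using `f_y(0) = 0` and `f_y(1 / g 0) ≥ (1 / g 0) g 0 = 1`). [folklore] -/
theorem exists_rayFun_eq_one {g : E4 → ℝ} (hg : Differentiable ℝ g) (hpos : ∀ x, 0 < g x)
    (hrad : ∀ x : E4, 0 ≤ fderiv ℝ g x x) (y : E4) :
    ∃ t : ℝ, t * g (t • y) = 1 := by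
  set t₀ : ℝ := (g 0)⁻¹ with ht₀
  have ht₀nn : 0 ≤ t₀ := inv_nonneg.2 (hpos 0).le
  have hcont : ContinuousOn (fun s : ℝ => s * g (s • y)) (Icc 0 t₀) :=
    (continuous_id.mul (hg.continuous.comp (continuous_id.smul continuous_const))).continuousOn
  have h1 : (1 : ℝ) ∈ Icc ((fun s : ℝ => s * g (s • y)) 0) ((fun s : ℝ => s * g (s • y)) t₀) := by
    refine ⟨by simp only [zero_mul]; exact zero_le_one, ?_⟩
    calc (1 : ℝ) = t₀ * g 0 := by rw [ht₀, inv_mul_cancel₀ (hpos 0).ne']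
      _ ≤ t₀ * g (t₀ • y) := mul_le_mul_of_nonneg_left (apply_zero_le hg hrad y ht₀nn) ht₀nn
  obtain ⟨t, -, ht⟩ := intermediate_value_Icc ht₀nn hcont h1
  exact ⟨t, ht⟩

/-! ### Bijectivity of `x ↦ g x • x` -/

/-- `x ↦ g x • x` is injective: if `g x • x = g y • y` then `y = s • x` with
`s = g x / g y`, and `f_x(s) = s g(s x) = s g y = g x = f_x(1)`, so `s = 1` by strict
monotonicity of the ray function. [folklore] -/
theorem injective_radial {g : E4 → ℝ} (hg : Differentiable ℝ g) (hpos : ∀ x, 0 < g x)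
    (hrad : ∀ x : E4, 0 ≤ fderiv ℝ g x x) :
    Injective (fun x : E4 => g x • x) := by
  intro x y h
  dsimp only at h
  set s : ℝ := (g y)⁻¹ * g x with hs
  have hy : y = s • x := by
    rw [hs, mul_smul, h, smul_smul, inv_mul_cancel₀ (hpos y).ne', one_smul]
  have hgy : g y ≠ 0 := (hpos y).ne'
  have key : s * g (s • x) = 1 * g ((1 : ℝ) • x) := by
    rw [← hy, one_smul, one_mul, hs]
    field_simp
  have hs1 : s = 1 := (strictMono_rayFun hg hpos hrad x).injective key
  rw [hy, hs1, one_smul]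

/-- `x ↦ g x • x` is surjective: with `t g(t y) = 1` one has `g(t y) • (t y) = y`.
[folklore] -/
theorem surjective_radial {g : E4 → ℝ} (hg : Differentiable ℝ g) (hpos : ∀ x, 0 < g x)
    (hrad : ∀ x : E4, 0 ≤ fderiv ℝ g x x) :
    Surjective (fun x : E4 => g x • x) := by
  intro y
  obtain ⟨t, ht⟩ := exists_rayFun_eq_one hg hpos hrad y
  refine ⟨t • y, ?_⟩
  dsimp only
  rw [smul_smul, mul_comm, ht, one_smul]

/-! ### The differential -/

/-- The differential of `x ↦ g x • x` at `x` is `v ↦ g x • v + (Dg_x v) • x`. [folklore] -/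
theorem hasFDerivAt_radial {g : E4 → ℝ} (hg : Differentiable ℝ g) (x : E4) :
    HasFDerivAt (fun y : E4 => g y • y)
      (g x • ContinuousLinearMap.id ℝ E4 + (fderiv ℝ g x).smulRight x) x :=
  (hg x).hasFDerivAt.smul (hasFDerivAt_id x)

/-- The differential `L v = g x • v + (Dg_x v) • x` is injective when `g x > 0` and
`0 ≤ Dg_x(x)`: applying `Dg_x` to `L v = 0` gives `Dg_x v · (g x + Dg_x x) = 0`, so `Dg_x v = 0`,
and then `g x • v = 0` forces `v = 0`. [folklore] -/
theorem injective_fderiv_radial {g : E4 → ℝ} (hpos : ∀ x, 0 < g x)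
    (hrad : ∀ x : E4, 0 ≤ fderiv ℝ g x x) (x : E4) :
    Injective (g x • ContinuousLinearMap.id ℝ E4 + (fderiv ℝ g x).smulRight x) := by
  set L : E4 →L[ℝ] E4 := g x • ContinuousLinearMap.id ℝ E4 + (fderiv ℝ g x).smulRight x with hL
  refine (injective_iff_map_eq_zero L).2 fun v hv => ?_
  have hLv : L v = g x • v + (fderiv ℝ g x v) • x := rfl
  rw [hLv] at hv
  have h1 : fderiv ℝ g x v * (g x + fderiv ℝ g x x) = 0 := by
    have h := congrArg (fderiv ℝ g x) hv
    rw [map_add, map_smul, map_smul, map_zero, smul_eq_mul, smul_eq_mul] at h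
    linear_combination h
  have h2 : fderiv ℝ g x v = 0 := by
    rcases mul_eq_zero.1 h1 with h | h
    · exact h
    · exact absurd h (add_pos_of_pos_of_nonneg (hpos x) (hrad x)).ne'
  rw [h2, zero_smul, add_zero] at hv
  exact (smul_eq_zero.1 hv).resolve_left (hpos x).ne'

/-- `x ↦ g x • x` is a `C^∞` local diffeomorphism of `ℝ⁴` at every point (inverse function
theorem on manifolds, the differential being an injective endomorphism of `ℝ⁴`). [folklore] -/
theorem isLocalDiffeomorph_radial {g : E4 → ℝ} (hg : ContDiff ℝ ∞ g) (hpos : ∀ x, 0 < g x)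
    (hrad : ∀ x : E4, 0 ≤ fderiv ℝ g x x) :
    IsLocalDiffeomorph 𝓘(ℝ, E4) 𝓘(ℝ, E4) ∞ (fun y : E4 => g y • y) := by
  intro x
  have hdiff : Differentiable ℝ g := hg.differentiable (by simp)
  set L : E4 →L[ℝ] E4 := g x • ContinuousLinearMap.id ℝ E4 + (fderiv ℝ g x).smulRight x with hL
  have hD : HasFDerivAt (fun y : E4 => g y • y) L x := hasFDerivAt_radial hdiff x
  have hinj : Injective L := injective_fderiv_radial hpos hrad x
  set e : E4 ≃L[ℝ] E4 :=
    (LinearEquiv.ofInjectiveEndo L.toLinearMap hinj).toContinuousLinearEquiv with he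
  have hecoe : (e : E4 →L[ℝ] E4) = L := by
    ext w
    rfl
  have hsmooth : ContDiff ℝ ∞ (fun y : E4 => g y • y) := hg.smul contDiff_id
  refine isLocalDiffeomorphAt_of_hasFDerivAt_writtenInExtChartAt (I := 𝓘(ℝ, E4))
    (J := 𝓘(ℝ, E4)) isOpen_univ (mem_univ x) (contMDiff_iff_contDiff.2 hsmooth).contMDiffOn
    (by exact_mod_cast (le_top : (1 : ℕ∞) ≤ ⊤)) e ?_
  rw [hecoe]
  simpa only [writtenInExtChartAt, extChartAt_model_space_eq_id, PartialEquiv.refl_coe,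
    PartialEquiv.refl_symm, CompTriple.comp_eq, id_eq] using hD

end RadialDiffeomorph

/-- **Stub Z3a — radial diffeomorphisms of `ℝ⁴`.**  If `g : ℝ⁴ → ℝ` is `C^∞`, positive, and
radially non-decreasing in the weak sense `0 ≤ Dg_x(x)` for every `x`, then `D(x) = g(x) • x` is
(the underlying map of) a diffeomorphism of `ℝ⁴`.  Proof: `D` is smooth with injective (hence
invertible) differential `v ↦ g x • v + (Dg_x v) • x`, so it is a local diffeomorphism everywhere
(inverse function theorem); on each ray `t ↦ t g(t x)` is strictly increasing with derivative
`g(tx) + Dg_{tx}(tx) > 0` and takes every value `≥ 0` (as `g(tx) ≥ g 0` for `t ≥ 0`), so `D` is a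
bijection; a bijective local diffeomorphism is a diffeomorphism. [folklore] -/
theorem stub_radialDiffeomorph :
    ∀ g : E4 → ℝ, ContDiff ℝ ∞ g → (∀ x, 0 < g x) → (∀ x : E4, 0 ≤ fderiv ℝ g x x) →
      ∃ D : E4 ≃ₘ⟮𝓡 4, 𝓡 4⟯ E4, ∀ x, D x = g x • x := by
  intro g hg hpos hrad
  have hdiff : Differentiable ℝ g := hg.differentiable (by simp)
  exact ⟨(RadialDiffeomorph.isLocalDiffeomorph_radial hg hpos hrad).diffeomorphOfBijective
      ⟨RadialDiffeomorph.injective_radial hdiff hpos hrad,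
        RadialDiffeomorph.surjective_radial hdiff hpos hrad⟩, fun _ => rfl⟩

end Summit.SmoothPoincare4.SmoothPoincare4.Theorems.SchsplitCerf.ContactIsotopyGromovCone

end
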